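import Literature.Claims.NS.Lam2019
import Literature.Analysis.FluidPDE.TotalVorticityFlux
import HarnessLib

/-!
# Solo salvage for claim C14 `Lam2019` (cell `ns-claims`, D-0090): the vorticity-flux invariance
# (8.14)–(8.17) is TRUE — identically, both sides vanish

Claim skeleton: `Literature/Claims/NS/Lam2019.lean` (typist `ns-claims-typist-4`; F. Lam, arXiv:1903.12098
v3, §8 «Vorticity bounds»). This file (seat `ns-claims-salvage-p3`) kernel-discharges the TRUE step
that precedes the predicted locator:

* `step2_invariance_holds : Step2_invariance` — (8.14)–(8.17) p. 41, «∫ ω(x,t) dx = ∫ ω₀(x) dx» (the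
  total vorticity flux `Ω₃` of Majda–Bertozzi (1.65) is conserved). For a `SlabSolution` every slice
  `u(t)` is `C^∞` and rapidly decaying (the structure's `decay` field; Fefferman's (4) at every
  time), so `∫ curl u(t) dx = 0` for every `t` (tree `integral_curl_apply_eq_zero_of_hasRapidSpatialDecay`,
  Leray 1934 (1.11): no boundary terms on `ℝ³`), and likewise `∫ curl u₀ dx = 0`. The invariant is
  thus IDENTICALLY ZERO on the whole class — which is why it can transmit no bound to `‖ω‖_{L¹}`
  ((8.18)–(8.19), `Step3_vorticityL1`): the «a-priori-bound-by-identity» pattern (barrier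
  `Literature.Barriers.NavierStokesRegularity.VortexStretching.VortexStretchingAprioriBounds`).

Solo lane (`Theorems/SoloSalvage<Slug>.lean`, no item).

WHAT THIS IS NOT: not a claim about NS regularity or blow-up; not a claim about any author beyond the
typed locator.
-/

noncomputable section

-- The summit-side namespace repeats the summit name by design (D-0017 layout); tree precedent
-- `SoloSalvageRamm2024.lean`.
set_option linter.dupNamespace false

open MeasureTheory Set

namespace Summit.NavierStokesRegularity.NavierStokesRegularity.Theorems.Lam2019Salvage

open Literature.Analysis.FluidPDE Literature.Claims.NS.Lam2019

/-- For a slab solution every component of the total vorticity flux vanishes at every time: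
`∫ curl u(t) dx · eᵢ = 0`, `t ∈ [0,T)` (rapidly decaying `C^∞` slices; Leray 1934 (1.11)). -/
theorem integral_curl_apply_eq_zero_of_slabSolution {ν T : ℝ}
    {u₀ : EuclideanSpace ℝ (Fin 3) → EuclideanSpace ℝ (Fin 3)}
    {u : ℝ → EuclideanSpace ℝ (Fin 3) → EuclideanSpace ℝ (Fin 3)}
    {p : ℝ → EuclideanSpace ℝ (Fin 3) → ℝ} (hS : SlabSolution ν T u₀ u p) {t : ℝ} (ht : t ∈ Ico 0 T)
    (i : Fin 3) : ∫ x, curl (u t) x i = 0 :=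
  integral_curl_apply_eq_zero_of_hasRapidSpatialDecay
    ((hS.solution.contDiff_velocity ht).of_le (by simp)) (hS.decay t ht) i

/-- The datum's total vorticity flux vanishes componentwise: `∫ curl u₀ dx · eᵢ = 0`. -/
theorem integral_curl_apply_data_eq_zero_of_slabSolution {ν T : ℝ}
    {u₀ : EuclideanSpace ℝ (Fin 3) → EuclideanSpace ℝ (Fin 3)}
    {u : ℝ → EuclideanSpace ℝ (Fin 3) → EuclideanSpace ℝ (Fin 3)}
    {p : ℝ → EuclideanSpace ℝ (Fin 3) → ℝ} (hS : SlabSolution ν T u₀ u p) (i : Fin 3) :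
    ∫ x, curl u₀ x i = 0 :=
  integral_curl_apply_eq_zero_of_hasRapidSpatialDecay (hS.data_smooth.of_le (by simp)) hS.data_decay i

/-- **`Step2_invariance` holds** ((8.14)–(8.17) p. 41: «∫ω(x,t) dx = ∫ω₀(x) dx»): both sides are
`0` for every slab solution, every `t ∈ [0,T)` and every component. -/
theorem step2_invariance_holds : Step2_invariance := by
  intro ν T u₀ u p hS t ht i
  rw [integral_curl_apply_eq_zero_of_slabSolution hS ht i,
    integral_curl_apply_data_eq_zero_of_slabSolution hS i]

end Summit.NavierStokesRegularity.NavierStokesRegularity.Theorems.Lam2019Salvage
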